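import Summits.Ventures.Crystal3D.Theorems.StickyWulffConstantNoReconstructionGainCubicFrame
import HarnessLib

/-!
# L3′: a point off the fcc lattice is at unit distance from at most three lattice sites

HONEST FRAMING. Part of the venture `Summits/Ventures/Crystal3D` (cell `crystal3d-full`), helper
`--supports` the crux `NoReconstructionGain` (stmt-Ventures-19144, route
`route-Ventures-StickyWulffConstant`), line `adhesion`.  The R26 support lemma **L3′** typed by
planner cf-p2 (`AdhesionOfPotential.lean`, «fcc four-contact rigidity»), registered by name:
`fcc_offLattice_unitContacts_le_three` — if `q ∉ Λ₀ = fccStacking 1 √(2/3)` then at most three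
sites of `Λ₀` are at distance exactly `1` from `q` (so a film ball that is not a registry site
touches `≤ 3` balls of ANY substrate made of lattice sites; formerly certified only by computation,
kit j259332 / cf-p2 R26 §0).

**Proof.**  Cubic frame (`…CubicFrame`): `Λ₀ ≅ D₃`, nearest-neighbour distance `√2`.  Take a site
`z*` with `‖q − z*‖² ≤ 1/2` and let `Q` be the cubic coordinates of `q − z*`, `0 < |Q|² = S ≤ 1`.  A
site at distance `1` from `q` has cubic coordinates `Z` with `|Q − Z|² = 2`, hence is a first
neighbour (`|Z|² = 2`, `⟨Z,Q⟩ = S/2`) or a second neighbour (`|Z|² = 4`, `⟨Z,Q⟩ = S/2 + 1`) of `z*`.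
Two second neighbours force `(S − 2)² ≤ 0`; so among four sites three are first neighbours
`z₁, z₂, z₃`, `Q ⟂ z₁ − z₂, z₁ − z₃`, and BAC–CAB gives `|n|² Q = ⟨Q,n⟩ n`, `n = (z₁−z₂) × (z₁−z₃)`,
whence `⟨Q,n⟩ = 2Δ`, `|n|² S = 4Δ²`, `Δ = ⟨z₁,n⟩ ≠ 0`, `4Δ² ≤ |n|²`, and a fourth site needs
`⟨z₄,n⟩ = Δ` (first) or `2Δ⟨z₄,n⟩ = 2Δ² + |n|²` (second neighbour) — `offLattice_bridge`.  A kernel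
`decide` over the `12³ × 18` integer cases (`offLattice_decideB`) shows no triple passes (the only
triples with `Δ ≠ 0`, `4Δ² ≤ |n|²` belong to `Q = (±2/5, 0, ±4/5)`, which has no fourth point).

WHAT THIS IS NOT: R26's L5 reduction itself is not formalised here; rung F-C1 not moved.
-/


noncomputable section

namespace Summit.Ventures.Crystal3D.Theorems

open Summit.Ventures.Crystal3D Finset
open Literature.MathematicalPhysics.StatisticalMechanics (barlowPos barlowStacking fccStacking
  constHagg haggLabel_const barlowPos_mem)

/-- **BAC–CAB.**  If `Q = (x, y, z)` is orthogonal to `d₁ = (a₁,a₂,a₃)` and `d₂ = (b₁,b₂,b₃)`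
then `|n|² Q = ⟨Q, n⟩ n` for `n = d₁ × d₂`. -/
theorem norm_sq_cross_mul_eq (x y z a₁ a₂ a₃ b₁ b₂ b₃ : ℝ) (h₁ : a₁ * x + a₂ * y + a₃ * z = 0)
    (h₂ : b₁ * x + b₂ * y + b₃ * z = 0) :
    ((a₂ * b₃ - a₃ * b₂) ^ 2 + (a₃ * b₁ - a₁ * b₃) ^ 2 + (a₁ * b₂ - a₂ * b₁) ^ 2) * x =
        (x * (a₂ * b₃ - a₃ * b₂) + y * (a₃ * b₁ - a₁ * b₃) + z * (a₁ * b₂ - a₂ * b₁)) *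
          (a₂ * b₃ - a₃ * b₂) ∧
      ((a₂ * b₃ - a₃ * b₂) ^ 2 + (a₃ * b₁ - a₁ * b₃) ^ 2 + (a₁ * b₂ - a₂ * b₁) ^ 2) * y =
        (x * (a₂ * b₃ - a₃ * b₂) + y * (a₃ * b₁ - a₁ * b₃) + z * (a₁ * b₂ - a₂ * b₁)) *
          (a₃ * b₁ - a₁ * b₃) ∧
      ((a₂ * b₃ - a₃ * b₂) ^ 2 + (a₃ * b₁ - a₁ * b₃) ^ 2 + (a₁ * b₂ - a₂ * b₁) ^ 2) * z =
        (x * (a₂ * b₃ - a₃ * b₂) + y * (a₃ * b₁ - a₁ * b₃) + z * (a₁ * b₂ - a₂ * b₁)) *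
          (a₁ * b₂ - a₂ * b₁) := by
  refine ⟨?_, ?_, ?_⟩
  · linear_combination ((a₃ * b₁ - a₁ * b₃) * a₃ - (a₁ * b₂ - a₂ * b₁) * a₂) * h₂ - ((a₃ * b₁ - a₁ * b₃) * b₃ - (a₁ * b₂ - a₂ * b₁) * b₂) * h₁
  · linear_combination ((a₁ * b₂ - a₂ * b₁) * a₁ - (a₂ * b₃ - a₃ * b₂) * a₃) * h₂ - ((a₁ * b₂ - a₂ * b₁) * b₁ - (a₂ * b₃ - a₃ * b₂) * b₃) * h₁
  · linear_combination ((a₂ * b₃ - a₃ * b₂) * a₂ - (a₃ * b₁ - a₁ * b₃) * a₁) * h₂ - ((a₂ * b₃ - a₃ * b₂) * b₂ - (a₃ * b₁ - a₁ * b₃) * b₁) * h₁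

/-- **Bridge.** `Q = (x,y,z)`, `S = |Q|² ∈ (0,1]`, integer `z₁, z₂, z₃` with `⟨zᵢ, Q⟩ = S/2`,
`n = (z₁−z₂) × (z₁−z₃) ≠ 0`, `Δ = ⟨z₁,n⟩`, `N = |n|²` ⇒ `Δ ≠ 0`, `4Δ² ≤ N`, `N Q = 2Δ n`, `N S = 4Δ²`. -/
theorem offLattice_bridge (x y z S : ℝ) (hS : x ^ 2 + y ^ 2 + z ^ 2 = S) (hS0 : 0 < S)
    (hS1 : S ≤ 1) (p₁ p₂ p₃ q₁ q₂ q₃ r₁ r₂ r₃ : ℤ)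
    (h₁ : (p₁ : ℝ) * x + p₂ * y + p₃ * z = S / 2) (h₂ : (q₁ : ℝ) * x + q₂ * y + q₃ * z = S / 2)
    (h₃ : (r₁ : ℝ) * x + r₂ * y + r₃ * z = S / 2) (n₁ n₂ n₃ Δ N : ℤ)
    (hn₁ : n₁ = (p₂ - q₂) * (p₃ - r₃) - (p₃ - q₃) * (p₂ - r₂))
    (hn₂ : n₂ = (p₃ - q₃) * (p₁ - r₁) - (p₁ - q₁) * (p₃ - r₃))
    (hn₃ : n₃ = (p₁ - q₁) * (p₂ - r₂) - (p₂ - q₂) * (p₁ - r₁))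
    (hΔ : Δ = p₁ * n₁ + p₂ * n₂ + p₃ * n₃) (hN : N = n₁ ^ 2 + n₂ ^ 2 + n₃ ^ 2)
    (hn0 : (n₁, n₂, n₃) ≠ ((0 : ℤ), (0 : ℤ), (0 : ℤ))) :
    Δ ≠ 0 ∧ 4 * Δ ^ 2 ≤ N ∧ (N : ℝ) * S = 4 * (Δ : ℝ) ^ 2 ∧
      (N : ℝ) * x = 2 * Δ * n₁ ∧ (N : ℝ) * y = 2 * Δ * n₂ ∧ (N : ℝ) * z = 2 * Δ * n₃ := by
  have hd₁ : ((p₁ - q₁ : ℤ) : ℝ) * x + ((p₂ - q₂ : ℤ) : ℝ) * y + ((p₃ - q₃ : ℤ) : ℝ) * z = 0 := by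
    push_cast; linarith
  have hd₂ : ((p₁ - r₁ : ℤ) : ℝ) * x + ((p₂ - r₂ : ℤ) : ℝ) * y + ((p₃ - r₃ : ℤ) : ℝ) * z = 0 := by
    push_cast; linarith
  obtain ⟨ex, ey, ez⟩ := norm_sq_cross_mul_eq x y z _ _ _ _ _ _ hd₁ hd₂
  have hn₁' : (n₁ : ℝ) = ((p₂ - q₂ : ℤ) : ℝ) * ((p₃ - r₃ : ℤ) : ℝ) - ((p₃ - q₃ : ℤ) : ℝ) * ((p₂ - r₂ : ℤ) : ℝ) := by
    rw [hn₁]; push_cast; ring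
  have hn₂' : (n₂ : ℝ) = ((p₃ - q₃ : ℤ) : ℝ) * ((p₁ - r₁ : ℤ) : ℝ) - ((p₁ - q₁ : ℤ) : ℝ) * ((p₃ - r₃ : ℤ) : ℝ) := by
    rw [hn₂]; push_cast; ring
  have hn₃' : (n₃ : ℝ) = ((p₁ - q₁ : ℤ) : ℝ) * ((p₂ - r₂ : ℤ) : ℝ) - ((p₂ - q₂ : ℤ) : ℝ) * ((p₁ - r₁ : ℤ) : ℝ) := by
    rw [hn₃]; push_cast; ring
  rw [← hn₁', ← hn₂', ← hn₃'] at ex ey ez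
  have hN' : (N : ℝ) = (n₁ : ℝ) ^ 2 + (n₂ : ℝ) ^ 2 + (n₃ : ℝ) ^ 2 := by rw [hN]; push_cast; ring
  have hΔ' : (Δ : ℝ) = (p₁ : ℝ) * n₁ + p₂ * n₂ + p₃ * n₃ := by rw [hΔ]; push_cast; ring
  set lam : ℝ := x * n₁ + y * n₂ + z * n₃ with hlam
  rw [← hN'] at ex ey ez
  have hNpos : (0 : ℝ) < N := by
    have : (0 : ℤ) < N := by
      by_contra hle
      push Not at hle
      have hsum : n₁ ^ 2 + n₂ ^ 2 + n₃ ^ 2 = 0 := le_antisymm (by rw [← hN]; exact hle) (by positivity)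
      have h12 := (add_eq_zero_iff_of_nonneg (by positivity) (sq_nonneg n₃)).1 hsum
      have h1 := (add_eq_zero_iff_of_nonneg (sq_nonneg n₁) (sq_nonneg n₂)).1 h12.1
      exact hn0 (by rw [(pow_eq_zero_iff two_ne_zero).1 h1.1, (pow_eq_zero_iff two_ne_zero).1 h1.2,
        (pow_eq_zero_iff two_ne_zero).1 h12.2])
    exact_mod_cast this
  have hNS : (N : ℝ) * S = lam ^ 2 := by
    linear_combination (-(N : ℝ)) * hS + x * ex + y * ey + z * ez - lam * hlam
  have hlamΔ : (N : ℝ) * (S / 2) = lam * Δ := by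
    rw [hΔ']
    linear_combination (-(N : ℝ)) * h₁ + (p₁ : ℝ) * ex + (p₂ : ℝ) * ey + (p₃ : ℝ) * ez
  have hlam2 : lam = 2 * Δ := by
    have hq : lam * (lam - 2 * Δ) = 0 := by linear_combination -hNS + 2 * hlamΔ
    rcases mul_eq_zero.1 hq with h0 | h0
    · exfalso
      have : (N : ℝ) * S = 0 := by rw [hNS, h0]; ring
      rcases mul_eq_zero.1 this with h | h
      · exact hNpos.ne' h
      · exact hS0.ne' h
    · linarith
  have hNS4 : (N : ℝ) * S = 4 * (Δ : ℝ) ^ 2 := by rw [hNS, hlam2]; ring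
  refine ⟨?_, ?_, hNS4, ?_, ?_, ?_⟩
  · intro hΔ0
    have : (N : ℝ) * S = 0 := by rw [hNS4, hΔ0]; simp
    rcases mul_eq_zero.1 this with h | h
    · exact hNpos.ne' h
    · exact hS0.ne' h
  · have : (4 : ℝ) * (Δ : ℝ) ^ 2 ≤ N := by nlinarith [hNS4, hNpos]
    exact_mod_cast this
  · rw [ex, hlam2]
  · rw [ey, hlam2]
  · rw [ez, hlam2]

/-- **Fourth point, first neighbour:** `⟨z₄, Q⟩ = S/2` forces `⟨z₄, n⟩ = Δ`. -/
theorem offLattice_fourth_first (x y z S : ℝ) (s₁ s₂ s₃ n₁ n₂ n₃ Δ N : ℤ) (hΔ : Δ ≠ 0)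
    (hNS : (N : ℝ) * S = 4 * (Δ : ℝ) ^ 2)
    (ex : (N : ℝ) * x = 2 * Δ * n₁) (ey : (N : ℝ) * y = 2 * Δ * n₂) (ez : (N : ℝ) * z = 2 * Δ * n₃)
    (h₄ : (s₁ : ℝ) * x + s₂ * y + s₃ * z = S / 2) : s₁ * n₁ + s₂ * n₂ + s₃ * n₃ = Δ := by
  have h : (2 : ℝ) * Δ * (s₁ * n₁ + s₂ * n₂ + s₃ * n₃) = 2 * Δ * Δ := by
    linear_combination (N : ℝ) * h₄ - (s₁ : ℝ) * ex - (s₂ : ℝ) * ey - (s₃ : ℝ) * ez + hNS / 2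
  have hΔ' : (Δ : ℝ) ≠ 0 := by exact_mod_cast hΔ
  have : ((s₁ * n₁ + s₂ * n₂ + s₃ * n₃ : ℤ) : ℝ) = Δ := by
    push_cast
    have := mul_left_cancel₀ (mul_ne_zero two_ne_zero hΔ') h
    linarith
  exact_mod_cast this

/-- **Fourth point, second neighbour:** `⟨z₄, Q⟩ = S/2 + 1` forces `2Δ⟨z₄, n⟩ = 2Δ² + N`. -/
theorem offLattice_fourth_second (x y z S : ℝ) (s₁ s₂ s₃ n₁ n₂ n₃ Δ N : ℤ)
    (hNS : (N : ℝ) * S = 4 * (Δ : ℝ) ^ 2)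
    (ex : (N : ℝ) * x = 2 * Δ * n₁) (ey : (N : ℝ) * y = 2 * Δ * n₂) (ez : (N : ℝ) * z = 2 * Δ * n₃)
    (h₄ : (s₁ : ℝ) * x + s₂ * y + s₃ * z = S / 2 + 1) :
    2 * Δ * (s₁ * n₁ + s₂ * n₂ + s₃ * n₃) = 2 * Δ ^ 2 + N := by
  have h : (2 : ℝ) * Δ * (s₁ * n₁ + s₂ * n₂ + s₃ * n₃) = 2 * (Δ : ℝ) ^ 2 + N := by
    linear_combination (N : ℝ) * h₄ - (s₁ : ℝ) * ex - (s₂ : ℝ) * ey - (s₃ : ℝ) * ez + hNS / 2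
  exact_mod_cast h

/-- **At most one second neighbour on the sphere** (two would force `(S − 2)² ≤ 0`). -/
theorem offLattice_secondNeighbours (x y z S : ℝ) (hS : x ^ 2 + y ^ 2 + z ^ 2 = S) (hS1 : S ≤ 1)
    (v w : ℤ × ℤ × ℤ)
    (hv : v ∈ ([((2 : ℤ), (0 : ℤ), (0 : ℤ)), (-2, 0, 0), (0, 2, 0), (0, -2, 0), (0, 0, 2), (0, 0, -2)] : List (ℤ × ℤ × ℤ)))
    (hw : w ∈ [((2 : ℤ), (0 : ℤ), (0 : ℤ)), (-2, 0, 0), (0, 2, 0), (0, -2, 0), (0, 0, 2), (0, 0, -2)])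
    (hvw : v ≠ w) (hvQ : (v.1 : ℝ) * x + v.2.1 * y + v.2.2 * z = S / 2 + 1)
    (hwQ : (w.1 : ℝ) * x + w.2.1 * y + w.2.2 * z = S / 2 + 1) : False := by
  have hx := sq_nonneg x; have hy := sq_nonneg y; have hz := sq_nonneg z
  simp only [List.mem_cons, List.not_mem_nil, or_false] at hv hw
  rcases hv with rfl | rfl | rfl | rfl | rfl | rfl <;>
  rcases hw with rfl | rfl | rfl | rfl | rfl | rfl <;>
  simp only [ne_eq, not_true_eq_false, Prod.mk.injEq] at hvw <;>
  push_cast at hvQ hwQ <;>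
  nlinarith [sq_nonneg (S - 2)]

/-- Norms of the first and second neighbours, and the linear form of the sphere equation. -/
theorem offLattice_neighbour_linear (x y z S : ℝ) (hS : x ^ 2 + y ^ 2 + z ^ 2 = S) (v : ℤ × ℤ × ℤ)
    (hsph : (x - v.1) ^ 2 + (y - v.2.1) ^ 2 + (z - v.2.2) ^ 2 = 2) :
    (v ∈ ([((1 : ℤ), (1 : ℤ), (0 : ℤ)), (1, -1, 0), (-1, 1, 0), (-1, -1, 0), (1, 0, 1), (1, 0, -1), (-1, 0, 1), (-1, 0, -1), (0, 1, 1), (0, 1, -1), (0, -1, 1), (0, -1, -1)] : List (ℤ × ℤ × ℤ)) →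
      (v.1 : ℝ) * x + v.2.1 * y + v.2.2 * z = S / 2) ∧
    (v ∈ ([((2 : ℤ), (0 : ℤ), (0 : ℤ)), (-2, 0, 0), (0, 2, 0), (0, -2, 0), (0, 0, 2), (0, 0, -2)] : List (ℤ × ℤ × ℤ)) →
      (v.1 : ℝ) * x + v.2.1 * y + v.2.2 * z = S / 2 + 1) := by
  constructor
  · intro hv
    have hn : (v.1 : ℝ) ^ 2 + (v.2.1 : ℝ) ^ 2 + (v.2.2 : ℝ) ^ 2 = 2 := by
      have : v.1 ^ 2 + v.2.1 ^ 2 + v.2.2 ^ 2 = 2 := by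
        simp only [List.mem_cons, List.not_mem_nil, or_false] at hv
        rcases hv with rfl | rfl | rfl | rfl | rfl | rfl | rfl | rfl | rfl | rfl | rfl | rfl <;> norm_num
      exact_mod_cast this
    nlinarith [hn, hsph, hS]
  · intro hv
    have hn : (v.1 : ℝ) ^ 2 + (v.2.1 : ℝ) ^ 2 + (v.2.2 : ℝ) ^ 2 = 4 := by
      have : v.1 ^ 2 + v.2.1 ^ 2 + v.2.2 ^ 2 = 4 := by
        simp only [List.mem_cons, List.not_mem_nil, or_false] at hv
        rcases hv with rfl | rfl | rfl | rfl | rfl | rfl <;> norm_num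
      exact_mod_cast this
    nlinarith [hn, hsph, hS]

/-- Choosing three good indices out of four when at most one is bad. -/
theorem exists_three_good (bad : Fin 4 → Bool) (h : ∀ i j, bad i = true → bad j = true → i = j) :
    ∃ i j k l : Fin 4, i ≠ j ∧ i ≠ k ∧ j ≠ k ∧ l ≠ i ∧ l ≠ j ∧ l ≠ k ∧
      bad i = false ∧ bad j = false ∧ bad k = false := by
  revert h bad
  decide

/-- **The finite check, Boolean form** (kernel `decide`): see `offLattice_decide`. -/
theorem offLattice_decideB :
    (([((1 : ℤ), (1 : ℤ), (0 : ℤ)), (1, -1, 0), (-1, 1, 0), (-1, -1, 0), (1, 0, 1), (1, 0, -1), (-1, 0, 1), (-1, 0, -1), (0, 1, 1), (0, 1, -1), (0, -1, 1), (0, -1, -1)] : List (ℤ × ℤ × ℤ)).all fun z1 =>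
      ([((1 : ℤ), (1 : ℤ), (0 : ℤ)), (1, -1, 0), (-1, 1, 0), (-1, -1, 0), (1, 0, 1), (1, 0, -1), (-1, 0, 1), (-1, 0, -1), (0, 1, 1), (0, 1, -1), (0, -1, 1), (0, -1, -1)] : List (ℤ × ℤ × ℤ)).all fun z2 =>
      ([((1 : ℤ), (1 : ℤ), (0 : ℤ)), (1, -1, 0), (-1, 1, 0), (-1, -1, 0), (1, 0, 1), (1, 0, -1), (-1, 0, 1), (-1, 0, -1), (0, 1, 1), (0, 1, -1), (0, -1, 1), (0, -1, -1)] : List (ℤ × ℤ × ℤ)).all fun z3 =>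
        decide (z1 = z2) || decide (z1 = z3) || decide (z2 = z3) ||
        (!decide ((((z1.2.1 - z2.2.1) * (z1.2.2 - z3.2.2) - (z1.2.2 - z2.2.2) * (z1.2.1 - z3.2.1)), ((z1.2.2 - z2.2.2) * (z1.1 - z3.1) - (z1.1 - z2.1) * (z1.2.2 - z3.2.2)), ((z1.1 - z2.1) * (z1.2.1 - z3.2.1) - (z1.2.1 - z2.2.1) * (z1.1 - z3.1))) = ((0 : ℤ), (0 : ℤ), (0 : ℤ))) &&
          (decide ((z1.1 * ((z1.2.1 - z2.2.1) * (z1.2.2 - z3.2.2) - (z1.2.2 - z2.2.2) * (z1.2.1 - z3.2.1)) + z1.2.1 * ((z1.2.2 - z2.2.2) * (z1.1 - z3.1) - (z1.1 - z2.1) * (z1.2.2 - z3.2.2)) + z1.2.2 * ((z1.1 - z2.1) * (z1.2.1 - z3.2.1) - (z1.2.1 - z2.2.1) * (z1.1 - z3.1))) = 0) ||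
            decide ((((z1.2.1 - z2.2.1) * (z1.2.2 - z3.2.2) - (z1.2.2 - z2.2.2) * (z1.2.1 - z3.2.1)) ^ 2 + ((z1.2.2 - z2.2.2) * (z1.1 - z3.1) - (z1.1 - z2.1) * (z1.2.2 - z3.2.2)) ^ 2 + ((z1.1 - z2.1) * (z1.2.1 - z3.2.1) - (z1.2.1 - z2.2.1) * (z1.1 - z3.1)) ^ 2) < 4 * (z1.1 * ((z1.2.1 - z2.2.1) * (z1.2.2 - z3.2.2) - (z1.2.2 - z2.2.2) * (z1.2.1 - z3.2.1)) + z1.2.1 * ((z1.2.2 - z2.2.2) * (z1.1 - z3.1) - (z1.1 - z2.1) * (z1.2.2 - z3.2.2)) + z1.2.2 * ((z1.1 - z2.1) * (z1.2.1 - z3.2.1) - (z1.2.1 - z2.2.1) * (z1.1 - z3.1))) ^ 2) ||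
            ((([((1 : ℤ), (1 : ℤ), (0 : ℤ)), (1, -1, 0), (-1, 1, 0), (-1, -1, 0), (1, 0, 1), (1, 0, -1), (-1, 0, 1), (-1, 0, -1), (0, 1, 1), (0, 1, -1), (0, -1, 1), (0, -1, -1)] : List (ℤ × ℤ × ℤ)).all fun z4 =>
                decide (z4 = z1) || decide (z4 = z2) || decide (z4 = z3) ||
                  !decide ((z4.1 * ((z1.2.1 - z2.2.1) * (z1.2.2 - z3.2.2) - (z1.2.2 - z2.2.2) * (z1.2.1 - z3.2.1)) + z4.2.1 * ((z1.2.2 - z2.2.2) * (z1.1 - z3.1) - (z1.1 - z2.1) * (z1.2.2 - z3.2.2)) + z4.2.2 * ((z1.1 - z2.1) * (z1.2.1 - z3.2.1) - (z1.2.1 - z2.2.1) * (z1.1 - z3.1))) = (z1.1 * ((z1.2.1 - z2.2.1) * (z1.2.2 - z3.2.2) - (z1.2.2 - z2.2.2) * (z1.2.1 - z3.2.1)) + z1.2.1 * ((z1.2.2 - z2.2.2) * (z1.1 - z3.1) - (z1.1 - z2.1) * (z1.2.2 - z3.2.2)) + z1.2.2 * ((z1.1 - z2.1) * (z1.2.1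 - z3.2.1) - (z1.2.1 - z2.2.1) * (z1.1 - z3.1))))) &&
             (([((2 : ℤ), (0 : ℤ), (0 : ℤ)), (-2, 0, 0), (0, 2, 0), (0, -2, 0), (0, 0, 2), (0, 0, -2)] : List (ℤ × ℤ × ℤ)).all fun z4 =>
                !decide (2 * (z1.1 * ((z1.2.1 - z2.2.1) * (z1.2.2 - z3.2.2) - (z1.2.2 - z2.2.2) * (z1.2.1 - z3.2.1)) + z1.2.1 * ((z1.2.2 - z2.2.2) * (z1.1 - z3.1) - (z1.1 - z2.1) * (z1.2.2 - z3.2.2)) + z1.2.2 * ((z1.1 - z2.1) * (z1.2.1 - z3.2.1) - (z1.2.1 - z2.2.1) * (z1.1 - z3.1))) * (z4.1 * ((z1.2.1 - z2.2.1) * (z1.2.2 - z3.2.2) - (z1.2.2 - z2.2.2) * (z1.2.1 - z3.2.1)) + z4.2.1 * ((z1.2.2 - z2.2.2) * (z1.1 - z3.1) - (z1.1 - z2.1) * (z1.2.2 - z3.2.2)) + z4.2.2 * ((z1.1 - z2.1) * (z1.2.1 - z3.2.1) - (z1.2.1 - z2.2.1) * (z1.1 - z3.1))) = 2 * (z1.1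 * ((z1.2.1 - z2.2.1) * (z1.2.2 - z3.2.2) - (z1.2.2 - z2.2.2) * (z1.2.1 - z3.2.1)) + z1.2.1 * ((z1.2.2 - z2.2.2) * (z1.1 - z3.1) - (z1.1 - z2.1) * (z1.2.2 - z3.2.2)) + z1.2.2 * ((z1.1 - z2.1) * (z1.2.1 - z3.2.1) - (z1.2.1 - z2.2.1) * (z1.1 - z3.1))) ^ 2 + (((z1.2.1 - z2.2.1) * (z1.2.2 - z3.2.2) - (z1.2.2 - z2.2.2) * (z1.2.1 - z3.2.1)) ^ 2 + ((z1.2.2 - z2.2.2) * (z1.1 - z3.1) - (z1.1 - z2.1) * (z1.2.2 - z3.2.2)) ^ 2 + ((z1.1 - z2.1) * (z1.2.1 - z3.2.1) - (z1.2.1 - z2.2.1) * (z1.1 - z3.1)) ^ 2))))))) = true := by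
  decide +kernel

/-- **The finite check.**  For every ordered triple of distinct first neighbours `z₁, z₂, z₃` of
`D₃`, with `n = (z₁ − z₂) × (z₁ − z₃)`, `Δ = ⟨z₁, n⟩`: `n ≠ 0`, and `Δ = 0`, or `|n|² < 4Δ²`, or no
fourth first neighbour has `⟨z₄, n⟩ = Δ` and no second neighbour has `2Δ⟨z₄, n⟩ = 2Δ² + |n|²`. -/
theorem offLattice_decide :
    ∀ z1 ∈ ([((1 : ℤ), (1 : ℤ), (0 : ℤ)), (1, -1, 0), (-1, 1, 0), (-1, -1, 0), (1, 0, 1), (1, 0, -1), (-1, 0, 1), (-1, 0, -1), (0, 1, 1), (0, 1, -1), (0, -1, 1), (0, -1, -1)] : List (ℤ × ℤ × ℤ)),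
    ∀ z2 ∈ ([((1 : ℤ), (1 : ℤ), (0 : ℤ)), (1, -1, 0), (-1, 1, 0), (-1, -1, 0), (1, 0, 1), (1, 0, -1), (-1, 0, 1), (-1, 0, -1), (0, 1, 1), (0, 1, -1), (0, -1, 1), (0, -1, -1)] : List (ℤ × ℤ × ℤ)),
    ∀ z3 ∈ ([((1 : ℤ), (1 : ℤ), (0 : ℤ)), (1, -1, 0), (-1, 1, 0), (-1, -1, 0), (1, 0, 1), (1, 0, -1), (-1, 0, 1), (-1, 0, -1), (0, 1, 1), (0, 1, -1), (0, -1, 1), (0, -1, -1)] : List (ℤ × ℤ × ℤ)),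
      z1 ≠ z2 → z1 ≠ z3 → z2 ≠ z3 →
      (((z1.2.1 - z2.2.1) * (z1.2.2 - z3.2.2) - (z1.2.2 - z2.2.2) * (z1.2.1 - z3.2.1)), ((z1.2.2 - z2.2.2) * (z1.1 - z3.1) - (z1.1 - z2.1) * (z1.2.2 - z3.2.2)), ((z1.1 - z2.1) * (z1.2.1 - z3.2.1) - (z1.2.1 - z2.2.1) * (z1.1 - z3.1))) ≠ ((0 : ℤ), (0 : ℤ), (0 : ℤ)) ∧
      ((z1.1 * ((z1.2.1 - z2.2.1) * (z1.2.2 - z3.2.2) - (z1.2.2 - z2.2.2) * (z1.2.1 - z3.2.1)) + z1.2.1 * ((z1.2.2 - z2.2.2) * (z1.1 - z3.1) - (z1.1 - z2.1) * (z1.2.2 - z3.2.2)) + z1.2.2 * ((z1.1 - z2.1) * (z1.2.1 - z3.2.1) - (z1.2.1 - z2.2.1) * (z1.1 - z3.1))) = 0 ∨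
        (((z1.2.1 - z2.2.1) * (z1.2.2 - z3.2.2) - (z1.2.2 - z2.2.2) * (z1.2.1 - z3.2.1)) ^ 2 + ((z1.2.2 - z2.2.2) * (z1.1 - z3.1) - (z1.1 - z2.1) * (z1.2.2 - z3.2.2)) ^ 2 + ((z1.1 - z2.1) * (z1.2.1 - z3.2.1) - (z1.2.1 - z2.2.1) * (z1.1 - z3.1)) ^ 2) < 4 * (z1.1 * ((z1.2.1 - z2.2.1) * (z1.2.2 - z3.2.2) - (z1.2.2 - z2.2.2) * (z1.2.1 - z3.2.1)) + z1.2.1 * ((z1.2.2 - z2.2.2) * (z1.1 - z3.1) - (z1.1 - z2.1) * (z1.2.2 - z3.2.2)) + z1.2.2 * ((z1.1 - z2.1) * (z1.2.1 - z3.2.1) - (z1.2.1 - z2.2.1) * (z1.1 - z3.1))) ^ 2 ∨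
        ((∀ z4 ∈ ([((1 : ℤ), (1 : ℤ), (0 : ℤ)), (1, -1, 0), (-1, 1, 0), (-1, -1, 0), (1, 0, 1), (1, 0, -1), (-1, 0, 1), (-1, 0, -1), (0, 1, 1), (0, 1, -1), (0, -1, 1), (0, -1, -1)] : List (ℤ × ℤ × ℤ)),
            z4 ≠ z1 → z4 ≠ z2 → z4 ≠ z3 → (z4.1 * ((z1.2.1 - z2.2.1) * (z1.2.2 - z3.2.2) - (z1.2.2 - z2.2.2) * (z1.2.1 - z3.2.1)) + z4.2.1 * ((z1.2.2 - z2.2.2) * (z1.1 - z3.1) - (z1.1 - z2.1) * (z1.2.2 - z3.2.2)) + z4.2.2 * ((z1.1 - z2.1) * (z1.2.1 - z3.2.1) - (z1.2.1 - z2.2.1) * (z1.1 - z3.1))) ≠ (z1.1 * ((z1.2.1 - z2.2.1) * (z1.2.2 - z3.2.2) - (z1.2.2 - z2.2.2) * (z1.2.1 - z3.2.1)) + z1.2.1 * ((z1.2.2 - z2.2.2) * (z1.1 - z3.1) - (z1.1 - z2.1) * (z1.2.2 - z3.2.2)) + z1.2.2 * ((z1.1 - z2.1) * (z1.2.1 -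 z3.2.1) - (z1.2.1 - z2.2.1) * (z1.1 - z3.1)))) ∧
         (∀ z4 ∈ ([((2 : ℤ), (0 : ℤ), (0 : ℤ)), (-2, 0, 0), (0, 2, 0), (0, -2, 0), (0, 0, 2), (0, 0, -2)] : List (ℤ × ℤ × ℤ)),
            2 * (z1.1 * ((z1.2.1 - z2.2.1) * (z1.2.2 - z3.2.2) - (z1.2.2 - z2.2.2) * (z1.2.1 - z3.2.1)) + z1.2.1 * ((z1.2.2 - z2.2.2) * (z1.1 - z3.1) - (z1.1 - z2.1) * (z1.2.2 - z3.2.2)) + z1.2.2 * ((z1.1 - z2.1) * (z1.2.1 - z3.2.1) - (z1.2.1 - z2.2.1) * (z1.1 - z3.1))) * (z4.1 * ((z1.2.1 - z2.2.1) * (z1.2.2 - z3.2.2) - (z1.2.2 - z2.2.2) * (z1.2.1 - z3.2.1)) + z4.2.1 * ((z1.2.2 - z2.2.2) * (z1.1 - z3.1) - (z1.1 - z2.1) * (z1.2.2 - z3.2.2)) + z4.2.2 * ((z1.1 - z2.1) * (z1.2.1 - z3.2.1) - (z1.2.1 - z2.2.1) * (z1.1 - z3.1))) ≠ 2 * (z1.1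 * ((z1.2.1 - z2.2.1) * (z1.2.2 - z3.2.2) - (z1.2.2 - z2.2.2) * (z1.2.1 - z3.2.1)) + z1.2.1 * ((z1.2.2 - z2.2.2) * (z1.1 - z3.1) - (z1.1 - z2.1) * (z1.2.2 - z3.2.2)) + z1.2.2 * ((z1.1 - z2.1) * (z1.2.1 - z3.2.1) - (z1.2.1 - z2.2.1) * (z1.1 - z3.1))) ^ 2 + (((z1.2.1 - z2.2.1) * (z1.2.2 - z3.2.2) - (z1.2.2 - z2.2.2) * (z1.2.1 - z3.2.1)) ^ 2 + ((z1.2.2 - z2.2.2) * (z1.1 - z3.1) - (z1.1 - z2.1) * (z1.2.2 - z3.2.2)) ^ 2 + ((z1.1 - z2.1) * (z1.2.1 - z3.2.1) - (z1.2.1 - z2.2.1) * (z1.1 - z3.1)) ^ 2)))) := by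
  have h := offLattice_decideB
  simp only [List.all_eq_true, Bool.or_eq_true, Bool.and_eq_true, Bool.not_eq_true',
    decide_eq_true_eq, decide_eq_false_iff_not] at h
  intro z1 hz1 z2 hz2 z3 hz3 h12 h13 h23
  rcases h z1 hz1 z2 hz2 z3 hz3 with ((h | h) | h) | ⟨hn, hrest⟩
  · exact absurd h h12
  · exact absurd h h13
  · exact absurd h h23
  · refine ⟨hn, ?_⟩
    rcases hrest with (h | h) | ⟨hA, hB⟩
    · exact Or.inl h
    · exact Or.inr (Or.inl h)
    · refine Or.inr (Or.inr ⟨fun z4 hz4 h41 h42 h43 => ?_, fun z4 hz4 => hB z4 hz4⟩)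
      rcases hA z4 hz4 with ((h | h) | h) | h
      exacts [absurd h h41, absurd h h42, absurd h h43, h]

/-- **Finite lemma.** No `Q` with `0 < |Q|² ≤ 1` has four distinct first/second neighbours of `D₃`
on the sphere `|Q − Z|² = 2`. -/
theorem offLattice_finite (x y z : ℝ) (h0 : 0 < x ^ 2 + y ^ 2 + z ^ 2)
    (h1 : x ^ 2 + y ^ 2 + z ^ 2 ≤ 1) (Z : Fin 4 → ℤ × ℤ × ℤ) (hZ : Function.Injective Z)
    (hmem : ∀ m, Z m ∈ ([((1 : ℤ), (1 : ℤ), (0 : ℤ)), (1, -1, 0), (-1, 1, 0), (-1, -1, 0), (1, 0, 1), (1, 0, -1), (-1, 0, 1), (-1, 0, -1), (0, 1, 1), (0, 1, -1), (0, -1, 1), (0, -1, -1)] : List (ℤ × ℤ × ℤ)) ∨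
      Z m ∈ ([((2 : ℤ), (0 : ℤ), (0 : ℤ)), (-2, 0, 0), (0, 2, 0), (0, -2, 0), (0, 0, 2), (0, 0, -2)] : List (ℤ × ℤ × ℤ)))
    (hsph : ∀ m, (x - (Z m).1) ^ 2 + (y - (Z m).2.1) ^ 2 + (z - (Z m).2.2) ^ 2 = 2) : False := by
  set S := x ^ 2 + y ^ 2 + z ^ 2 with hSdef
  have hS : x ^ 2 + y ^ 2 + z ^ 2 = S := rfl
  have hlin := fun m => offLattice_neighbour_linear x y z S hS (Z m) (hsph m)
  let bad : Fin 4 → Bool := fun m => decide (Z m ∈ ([((2 : ℤ), (0 : ℤ), (0 : ℤ)), (-2, 0, 0), (0, 2, 0), (0, -2, 0), (0, 0, 2), (0, 0, -2)] : List (ℤ × ℤ × ℤ)))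
  have hbad1 : ∀ i j, bad i = true → bad j = true → i = j := by
    intro i j hi hj
    simp only [bad, decide_eq_true_eq] at hi hj
    by_contra hij
    exact offLattice_secondNeighbours x y z S hS h1 (Z i) (Z j) hi hj (fun h => hij (hZ h))
      ((hlin i).2 hi) ((hlin j).2 hj)
  obtain ⟨i, j, k, l, hij, hik, hjk, hli, hlj, hlk, hi, hj, hk⟩ := exists_three_good bad hbad1
  simp only [bad, decide_eq_false_iff_not] at hi hj hk
  have hi1 := (hmem i).resolve_right hi
  have hj1 := (hmem j).resolve_right hj
  have hk1 := (hmem k).resolve_right hk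
  obtain ⟨hn0, hdisj⟩ := offLattice_decide (Z i) hi1 (Z j) hj1 (Z k) hk1
    (fun h => hij (hZ h)) (fun h => hik (hZ h)) (fun h => hjk (hZ h))
  obtain ⟨hΔ, h4Δ, hNS, ex, ey, ez⟩ := offLattice_bridge x y z S hS h0 h1
    (Z i).1 (Z i).2.1 (Z i).2.2 (Z j).1 (Z j).2.1 (Z j).2.2 (Z k).1 (Z k).2.1 (Z k).2.2
    ((hlin i).1 hi1) ((hlin j).1 hj1) ((hlin k).1 hk1) _ _ _ _ _ rfl rfl rfl rfl rfl hn0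
  rcases hdisj with hΔ0 | hlt | ⟨hfirst, hsecond⟩
  · exact hΔ hΔ0
  · exact absurd h4Δ (not_le.2 hlt)
  · rcases hmem l with hl1 | hl2
    · exact hfirst (Z l) hl1 (fun h => hli (hZ h)) (fun h => hlj (hZ h)) (fun h => hlk (hZ h))
        (offLattice_fourth_first x y z S _ _ _ _ _ _ _ _ hΔ hNS ex ey ez ((hlin l).1 hl1))
    · exact hsecond (Z l) hl2
        (offLattice_fourth_second x y z S _ _ _ _ _ _ _ _ hNS ex ey ez ((hlin l).2 hl2))

/-- Cubic coordinates of a site relative to a site are an even-sum integer triple. -/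
theorem cubic_site_sub (y : EuclideanSpace ℝ (Fin 3)) (hy : y ∈ fccStacking 1 (Real.sqrt (2 / 3)))
    (k₀ i₀ j₀ : ℤ) :
    ∃ Z : ℤ × ℤ × ℤ, Even (Z.1 + Z.2.1 + Z.2.2) ∧
      (y - barlowPos 1 (Real.sqrt (2 / 3)) constHagg k₀ i₀ j₀) 0 +
          Real.sqrt 3 / 3 * (y - barlowPos 1 (Real.sqrt (2 / 3)) constHagg k₀ i₀ j₀) 1 -
          Real.sqrt (2 / 3) * (y - barlowPos 1 (Real.sqrt (2 / 3)) constHagg k₀ i₀ j₀) 2 = Z.1 ∧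
      (y - barlowPos 1 (Real.sqrt (2 / 3)) constHagg k₀ i₀ j₀) 0 -
          Real.sqrt 3 / 3 * (y - barlowPos 1 (Real.sqrt (2 / 3)) constHagg k₀ i₀ j₀) 1 +
          Real.sqrt (2 / 3) * (y - barlowPos 1 (Real.sqrt (2 / 3)) constHagg k₀ i₀ j₀) 2 = Z.2.1 ∧
      2 * Real.sqrt 3 / 3 * (y - barlowPos 1 (Real.sqrt (2 / 3)) constHagg k₀ i₀ j₀) 1 +
          Real.sqrt (2 / 3) * (y - barlowPos 1 (Real.sqrt (2 / 3)) constHagg k₀ i₀ j₀) 2 = Z.2.2 := by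
  obtain ⟨k, i, j, rfl⟩ := hy
  rw [barlowPos_fcc_sub]
  obtain ⟨hA, hB, hC⟩ := cubic_barlowPos (k - k₀) (i - i₀) (j - j₀)
  refine ⟨((i - i₀) + (j - j₀), (i - i₀) + (k - k₀), (j - j₀) + (k - k₀)),
    ⟨(i - i₀) + (j - j₀) + (k - k₀), by ring⟩, ?_, ?_, ?_⟩
  · rw [hA]; push_cast; ring
  · rw [hB]; push_cast; ring
  · rw [hC]; push_cast; ring

/-- The unit-distance equation in cubic coordinates relative to a common base point `zs`. -/
theorem cubic_sphere_eq (q y zs : EuclideanSpace ℝ (Fin 3)) (hd : dist q y = 1) (X Y W : ℝ)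
    (hX : X = (q - zs) 0 + Real.sqrt 3 / 3 * (q - zs) 1 - Real.sqrt (2 / 3) * (q - zs) 2)
    (hY : Y = (q - zs) 0 - Real.sqrt 3 / 3 * (q - zs) 1 + Real.sqrt (2 / 3) * (q - zs) 2)
    (hW : W = 2 * Real.sqrt 3 / 3 * (q - zs) 1 + Real.sqrt (2 / 3) * (q - zs) 2) (a b c : ℝ)
    (ha : (y - zs) 0 + Real.sqrt 3 / 3 * (y - zs) 1 - Real.sqrt (2 / 3) * (y - zs) 2 = a)
    (hb : (y - zs) 0 - Real.sqrt 3 / 3 * (y - zs) 1 + Real.sqrt (2 / 3) * (y - zs) 2 = b)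
    (hc : 2 * Real.sqrt 3 / 3 * (y - zs) 1 + Real.sqrt (2 / 3) * (y - zs) 2 = c) :
    (X - a) ^ 2 + (Y - b) ^ 2 + (W - c) ^ 2 = 2 := by
  have h2 := two_mul_norm_sq_eq_cubic (q - y)
  rw [← dist_eq_norm, hd] at h2
  have e : ∀ l, (q - y) l = (q - zs) l - (y - zs) l := fun l => by
    simp only [PiLp.sub_apply]; ring
  rw [e 0, e 1, e 2] at h2
  rw [hX, hY, hW, ← ha, ← hb, ← hc]
  linear_combination (-1 : ℝ) * h2

/-- Sites with equal cubic coordinates (relative to a common base point) are equal. -/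
theorem eq_of_cubic_sub_eq (y y' zs : EuclideanSpace ℝ (Fin 3))
    (ha : (y - zs) 0 + Real.sqrt 3 / 3 * (y - zs) 1 - Real.sqrt (2 / 3) * (y - zs) 2 =
      (y' - zs) 0 + Real.sqrt 3 / 3 * (y' - zs) 1 - Real.sqrt (2 / 3) * (y' - zs) 2)
    (hb : (y - zs) 0 - Real.sqrt 3 / 3 * (y - zs) 1 + Real.sqrt (2 / 3) * (y - zs) 2 =
      (y' - zs) 0 - Real.sqrt 3 / 3 * (y' - zs) 1 + Real.sqrt (2 / 3) * (y' - zs) 2)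
    (hc : 2 * Real.sqrt 3 / 3 * (y - zs) 1 + Real.sqrt (2 / 3) * (y - zs) 2 =
      2 * Real.sqrt 3 / 3 * (y' - zs) 1 + Real.sqrt (2 / 3) * (y' - zs) 2) : y = y' := by
  have h2 := two_mul_norm_sq_eq_cubic (y - y')
  have e : ∀ l, (y - y') l = (y - zs) l - (y' - zs) l := fun l => by
    simp only [PiLp.sub_apply]; ring
  rw [e 0, e 1, e 2] at h2
  have hn : ‖y - y'‖ ^ 2 = 0 := by nlinarith [h2, ha, hb, hc]
  rwa [sq_eq_zero_iff, norm_eq_zero, sub_eq_zero] at hn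

/-- **L3′ (fcc four-contact rigidity; R26 target typed by planner cf-p2, registered by name on
stmt-Ventures-19144).**  A point off the model fcc lattice `Λ₀ = fccStacking 1 √(2/3)` is at unit
distance from at most three lattice sites; hence a film ball that is not a registry site touches at
most three balls of any substrate made of lattice sites. -/
theorem fcc_offLattice_unitContacts_le_three : ∀ q : EuclideanSpace ℝ (Fin 3),
    q ∉ fccStacking 1 (Real.sqrt (2 / 3)) → ∀ S : Finset (EuclideanSpace ℝ (Fin 3)),
    (∀ y ∈ S, y ∈ fccStacking 1 (Real.sqrt (2 / 3)) ∧ dist q y = 1) → S.card ≤ 3 := by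
  intro q hq T hT
  classical
  by_contra hcard
  push Not at hcard
  obtain ⟨T4, hT4T, hT4card⟩ := Finset.exists_subset_card_eq (show 4 ≤ T.card by omega)
  have e : Fin 4 ≃ T4 := (T4.equivFinOfCardEq hT4card).symm
  have hyinj : Function.Injective (fun m : Fin 4 => ((e m : T4) : EuclideanSpace ℝ (Fin 3))) :=
    fun m m' h => e.injective (Subtype.ext h)
  have hyT : ∀ m : Fin 4, ((e m : T4) : EuclideanSpace ℝ (Fin 3)) ∈ fccStacking 1 (Real.sqrt (2 / 3)) ∧
      dist q ((e m : T4) : EuclideanSpace ℝ (Fin 3)) = 1 := fun m => hT _ (hT4T (e m).2)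
  obtain ⟨zs, hzs, hqzs⟩ := exists_fcc_dist_sq_le_half q
  obtain ⟨k₀, i₀, j₀, rfl⟩ := hzs
  obtain ⟨X, hX⟩ : ∃ X : ℝ, X = (q - barlowPos 1 (Real.sqrt (2 / 3)) constHagg k₀ i₀ j₀) 0 +
      Real.sqrt 3 / 3 * (q - barlowPos 1 (Real.sqrt (2 / 3)) constHagg k₀ i₀ j₀) 1 -
      Real.sqrt (2 / 3) * (q - barlowPos 1 (Real.sqrt (2 / 3)) constHagg k₀ i₀ j₀) 2 := ⟨_, rfl⟩
  obtain ⟨Y, hY⟩ : ∃ Y : ℝ, Y = (q - barlowPos 1 (Real.sqrt (2 / 3)) constHagg k₀ i₀ j₀) 0 -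
      Real.sqrt 3 / 3 * (q - barlowPos 1 (Real.sqrt (2 / 3)) constHagg k₀ i₀ j₀) 1 +
      Real.sqrt (2 / 3) * (q - barlowPos 1 (Real.sqrt (2 / 3)) constHagg k₀ i₀ j₀) 2 := ⟨_, rfl⟩
  obtain ⟨W, hW⟩ : ∃ W : ℝ, W = 2 * Real.sqrt 3 / 3 * (q - barlowPos 1 (Real.sqrt (2 / 3)) constHagg k₀ i₀ j₀) 1 +
      Real.sqrt (2 / 3) * (q - barlowPos 1 (Real.sqrt (2 / 3)) constHagg k₀ i₀ j₀) 2 := ⟨_, rfl⟩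
  have hnorm : 2 * ‖q - barlowPos 1 (Real.sqrt (2 / 3)) constHagg k₀ i₀ j₀‖ ^ 2 =
      X ^ 2 + Y ^ 2 + W ^ 2 := by
    rw [hX, hY, hW]; exact two_mul_norm_sq_eq_cubic _
  have h1 : X ^ 2 + Y ^ 2 + W ^ 2 ≤ 1 := by linarith
  have h0 : 0 < X ^ 2 + Y ^ 2 + W ^ 2 := by
    have hne : q - barlowPos 1 (Real.sqrt (2 / 3)) constHagg k₀ i₀ j₀ ≠ 0 := by
      intro h
      rw [sub_eq_zero] at h
      exact hq (h ▸ barlowPos_mem _ _ _)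
    have := norm_pos_iff.2 hne
    nlinarith
  choose Z hZe hZA hZB hZC using fun m : Fin 4 => cubic_site_sub _ (hyT m).1 k₀ i₀ j₀
  have hsph : ∀ m, (X - (Z m).1) ^ 2 + (Y - (Z m).2.1) ^ 2 + (W - (Z m).2.2) ^ 2 = 2 :=
    fun m => cubic_sphere_eq q _ _ (hyT m).2 X Y W hX hY hW _ _ _ (hZA m) (hZB m) (hZC m)
  have hmem : ∀ m, Z m ∈ ([((1 : ℤ), (1 : ℤ), (0 : ℤ)), (1, -1, 0), (-1, 1, 0), (-1, -1, 0), (1, 0, 1), (1, 0, -1), (-1, 0, 1), (-1, 0, -1), (0, 1, 1), (0, 1, -1), (0, -1, 1), (0, -1, -1)] : List (ℤ × ℤ × ℤ)) ∨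
      Z m ∈ ([((2 : ℤ), (0 : ℤ), (0 : ℤ)), (-2, 0, 0), (0, 2, 0), (0, -2, 0), (0, 0, 2), (0, 0, -2)] : List (ℤ × ℤ × ℤ)) := by
    intro m
    have hlt : (Z m).1 ^ 2 + (Z m).2.1 ^ 2 + (Z m).2.2 ^ 2 < 6 := by
      have hR : ((Z m).1 : ℝ) ^ 2 + ((Z m).2.1 : ℝ) ^ 2 + ((Z m).2.2 : ℝ) ^ 2 < 6 := by
        nlinarith [hsph m, h1, sq_nonneg (7 * (((Z m).1 : ℝ) - X) - 10 * X),
          sq_nonneg (7 * (((Z m).2.1 : ℝ) - Y) - 10 * Y), sq_nonneg (7 * (((Z m).2.2 : ℝ) - W) - 10 * W)]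
      exact_mod_cast hR
    rcases short_even_vectors _ _ _ (hZe m) hlt with hzero | hN1 | hN2
    · exfalso
      simp only [Prod.mk.injEq] at hzero
      obtain ⟨ha, hb, hc⟩ := hzero
      have := hsph m
      rw [ha, hb, hc] at this
      push_cast at this
      nlinarith [this, h1]
    · exact Or.inl hN1
    · exact Or.inr hN2
  have hZinj : Function.Injective Z := by
    intro m m' hmm
    apply hyinj
    apply eq_of_cubic_sub_eq _ _ (barlowPos 1 (Real.sqrt (2 / 3)) constHagg k₀ i₀ j₀)
    · rw [hZA m, hZA m', hmm]
    · rw [hZB m, hZB m', hmm]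
    · rw [hZC m, hZC m', hmm]
  exact offLattice_finite X Y W h0 h1 Z hZinj hmem hsph

end Summit.Ventures.Crystal3D.Theorems
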